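import Summits.NavierStokesRegularity.FunctionalMining.NoGo.StretchingHolderDeficit
import HarnessLib

/-!
(Part 2/3 of the no-go seat's staged `StretchingSupNotSharp` — split by the prove seat for the 400-line cap; this part: the endgame and `stretchingSupBound_of_strainL4Bound`, `not_stretchingSupSharp_of_strainL4Bound`.)
# Functional mining: Hölder's constant `2/√3` is NOT sharp — `StretchingSupSharp` fails (K1-Q1)

Search for candidate a priori estimates; no regularity claim.

Cell `pub-nsfunc`, no-go seat (gen 5), STAGED for the prove seat (target tree path
`Summits/NavierStokesRegularity/FunctionalMining/NoGo/StretchingSupNotSharp.lean`). Paper write-up: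
`HOME/pub-nsfunc-nogo/K1Q1.md` [ours, UNREVIEWED].

THEOREM (static, on `𝕋³`). If `K ≥ 0` is a constant with `∫|S|_F⁴ ≤ K ∫|ω|⁴` for all smooth
divergence-free `v` (`StrainL4Bound K`; such a `K` exists by the periodic Calderón–Zygmund
inequality, tree `BDSV.exists_eLpNorm_twoStrain_le_curl` at `p = 4`), then the static stretching
bound holds with a constant STRICTLY below Hölder's:
`StretchingSupBound (2/√3 − 1/(4√3(4K+1)))` (`stretchingSupBound_of_strainL4Bound`). Hence
`StrainL4Bound K → ¬ StretchingSupSharp` (`not_stretchingSupSharp_of_strainL4Bound`), and — the `L⁴`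
bound being a tree theorem on `T³` (`exists_strainL4Bound_fin3`, `K = (2187/16)·C₄⁴`) —
UNCONDITIONALLY `¬ StretchingSupSharp (d := Fin 3)` (`not_stretchingSupSharp_fin3`), equivalently
`∃ C < 2/√3, StretchingSupBound (d := Fin 3) C` (`exists_stretchingSupBound_lt_holder`). The
dictionary question K1-Q1 ("is Hölder's `2/√3` the optimal static constant?") is thereby DECIDED: no.
The improvement `δ = 1/(4√3(4K+1))` is not numerically explicit (the tree's Calderón–Zygmund constant
`C₄` is existential); the optimal constant remains unknown (numerical evidence `≈ 0.25`, NOGO.md §1).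

MECHANISM. (E1) Hölder with the Cauchy–Schwarz deficit: `σ ≤ (M/√3)(2ℰ − ½∫(√2|S| − |ω|)²)`
(pointwise `ωᵀSω ≤ M√(2/3)|S||ω| = (M/√3)(|S|² + ½|ω|² − ½(√2|S| − |ω|)²)`).
(E2) Betchov–Miller `σ = −4∫det S ≤ (2√6/9)∫|S|³` (tree `neg_integral_stretching_le_strain_cube`)
and `|S|³ ≤ ½M|S||ω| + …`, the remainder being `≤ (M/4t)(√2|S|−|ω|)² + (t/4M)(4|S|⁴ + 2|S|²|ω|²)`
pointwise (Young), whose integral the `L⁴` bound controls: `σ ≤ (2√6/9)M[ℰ/√2 + Δ/(4t) + t(2K+½)ℰ]`,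
`Δ = ∫(√2|S| − |ω|)²`. With `t = 1/(8K+2)`: if `Δ ≥ ℰ/(8K+2)` then (E1) gives the constant
`2/√3 − 1/(4√3(4K+1))`; otherwise (E2) gives `(2√6/9)(1/√2 + ½) ≈ 0.657`. No time, no solutions.
-/

noncomputable section

open Set MeasureTheory Finset
open scoped InnerProductSpace RealInnerProductSpace ENNReal NNReal

namespace Summit.NavierStokesRegularity.FunctionalMining

open Literature.Analysis.FunctionSpaces Literature.Analysis.FluidPDE

variable {d : Type*} [Fintype d] [DecidableEq d]

/-! ## The theorem: a constant strictly below `2/√3` -/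

/-- Numerical endgame: the two estimates (E1), (E2) (at `t = 1/(8K+2)`) give the constant
`2/√3 − 1/(4√3(4K+1))`. Pure real arithmetic. [folklore] -/
theorem stretching_endgame {K E M Δ σ : ℝ} (hK : 0 ≤ K) (hE : 0 ≤ E) (hM : 0 ≤ M)
    (h1 : σ ≤ M / Real.sqrt 3 * (2 * E - Δ / 2))
    (h2 : σ ≤ 2 / 9 * Real.sqrt 6 *
      (M * E / Real.sqrt 2 + M * ((8 * K + 2) / 4) * Δ + M * E / 4)) :
    σ ≤ (2 / Real.sqrt 3 - 1 / (4 * Real.sqrt 3 * (4 * K + 1))) * M * E := by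
  have hs2 : 0 < Real.sqrt 2 := Real.sqrt_pos.2 (by norm_num)
  have hs3 : 0 < Real.sqrt 3 := Real.sqrt_pos.2 (by norm_num)
  have hsq2 : Real.sqrt 2 ^ 2 = 2 := Real.sq_sqrt (by norm_num)
  have hsq3 : Real.sqrt 3 ^ 2 = 3 := Real.sq_sqrt (by norm_num)
  have h6 : Real.sqrt 6 = Real.sqrt 2 * Real.sqrt 3 := by
    rw [show (6 : ℝ) = 2 * 3 by norm_num, Real.sqrt_mul (by norm_num : (0 : ℝ) ≤ 2)]
  have hME : 0 ≤ M * E := mul_nonneg hM hE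
  have hK1 : 0 < 4 * K + 1 := by linarith
  -- crude decimal bounds on the square roots
  have hs2u : Real.sqrt 2 ≤ 3 / 2 := by nlinarith [hsq2, hs2]
  have hs3u : Real.sqrt 3 ≤ 7 / 4 := by nlinarith [hsq3, hs3]
  have hs3l : 17 / 10 ≤ Real.sqrt 3 := by nlinarith [hsq3, hs3]
  -- the target coefficient is at least `0.99`
  have hcoef : 99 / 100 ≤ 2 / Real.sqrt 3 - 1 / (4 * Real.sqrt 3 * (4 * K + 1)) := by
    have ha : 8 / 7 ≤ 2 / Real.sqrt 3 := by
      rw [le_div_iff₀ hs3]; nlinarith [hs3u]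
    have hb : 1 / (4 * Real.sqrt 3 * (4 * K + 1)) ≤ 1 / (4 * Real.sqrt 3) := by
      apply one_div_le_one_div_of_le (by positivity)
      nlinarith [hs3, hK]
    have hc : 1 / (4 * Real.sqrt 3) ≤ 15 / 100 := by
      rw [div_le_iff₀ (by positivity)]; nlinarith [hs3l]
    linarith
  by_cases hcase : E / (8 * K + 2) ≤ Δ
  · -- (E1) with `Δ ≥ E/(8K+2)`: exactly the displayed constant
    have hq : M / Real.sqrt 3 * (2 * E - Δ / 2) ≤
        M / Real.sqrt 3 * (2 * E - E / (8 * K + 2) / 2) := by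
      apply mul_le_mul_of_nonneg_left _ (div_nonneg hM hs3.le)
      linarith
    have heq : M / Real.sqrt 3 * (2 * E - E / (8 * K + 2) / 2) =
        (2 / Real.sqrt 3 - 1 / (4 * Real.sqrt 3 * (4 * K + 1))) * M * E := by
      field_simp
      ring
    linarith [h1, hq, heq.le]
  · -- (E2) with `Δ < E/(8K+2)`: the constant `(2√6/9)(1/√2 + ½) ≤ 0.67 ≤ 0.99`
    rw [not_le] at hcase
    have hΔ' : M * ((8 * K + 2) / 4) * Δ ≤ M * E / 4 := by
      have h8 : 0 < 8 * K + 2 := by linarith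
      have : (8 * K + 2) / 4 * Δ ≤ E / 4 := by
        rw [div_mul_eq_mul_div, div_le_div_iff_of_pos_right (by norm_num : (0:ℝ) < 4)]
        have := (lt_div_iff₀ h8).1 hcase
        nlinarith
      have := mul_le_mul_of_nonneg_left this hM
      linarith [this]
    -- `M E/√2 = (√2/2) M E`
    have hinv : M * E / Real.sqrt 2 = Real.sqrt 2 / 2 * (M * E) := by
      field_simp
      nlinarith [hsq2]
    have hb : σ ≤ 2 / 9 * Real.sqrt 6 * (Real.sqrt 2 / 2 * (M * E) + M * E / 4 + M * E / 4) := by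
      have hmono : M * E / Real.sqrt 2 + M * ((8 * K + 2) / 4) * Δ + M * E / 4 ≤
          Real.sqrt 2 / 2 * (M * E) + M * E / 4 + M * E / 4 := by rw [← hinv]; linarith
      have h60 : 0 ≤ 2 / 9 * Real.sqrt 6 := by positivity
      exact h2.trans (mul_le_mul_of_nonneg_left hmono h60)
    -- `(2/9)√6(√2/2 + ½) = (2/9)(√3 + √6/2) ≤ 0.67`
    have hnum : 2 / 9 * Real.sqrt 6 * (Real.sqrt 2 / 2 + 1 / 4 + 1 / 4) ≤ 67 / 100 := by
      rw [h6]
      nlinarith [hsq2, hs2u, hs3u, hs2, hs3, mul_pos hs2 hs3]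
    have hfin : 2 / 9 * Real.sqrt 6 * (Real.sqrt 2 / 2 * (M * E) + M * E / 4 + M * E / 4) =
        (2 / 9 * Real.sqrt 6 * (Real.sqrt 2 / 2 + 1 / 4 + 1 / 4)) * (M * E) := by ring
    rw [hfin] at hb
    calc σ ≤ (2 / 9 * Real.sqrt 6 * (Real.sqrt 2 / 2 + 1 / 4 + 1 / 4)) * (M * E) := hb
      _ ≤ 67 / 100 * (M * E) := mul_le_mul_of_nonneg_right hnum hME
      _ ≤ (2 / Real.sqrt 3 - 1 / (4 * Real.sqrt 3 * (4 * K + 1))) * (M * E) :=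
          mul_le_mul_of_nonneg_right (by linarith [hcoef]) hME
      _ = (2 / Real.sqrt 3 - 1 / (4 * Real.sqrt 3 * (4 * K + 1))) * M * E := by ring

/-- **THEOREM (K1-Q1 decided: Hölder's `2/√3` is not optimal).** If `∫|S|⁴ ≤ K∫|ω|⁴` for all
smooth divergence-free fields on `T³` (`StrainL4Bound K`, `K ≥ 0`), then the static stretching bound
holds with the constant `2/√3 − 1/(4√3(4K+1)) < 2/√3`:
`∫⟪(v·∇)v, Δv⟫ ≤ (2/√3 − 1/(4√3(4K+1)))·M·ℰ(v)` whenever `|ω|² ≤ M²` pointwise.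
Proof: (E1) Hölder with the Cauchy–Schwarz deficit `Δ = ∫(√2|S| − |ω|)²`; (E2) Betchov–Miller
`σ ≤ (2√6/9)∫|S|³` plus the pointwise Young split of `|S|³`, the quartic remainder being paid by
the `L⁴` bound; endgame `stretching_endgame`. [ours, UNREVIEWED — K1Q1.md] -/
theorem stretchingSupBound_of_strainL4Bound {K : ℝ} (hK : 0 ≤ K)
    (hCZ : StrainL4Bound (d := d) K) :
    StretchingSupBound (d := d) (2 / Real.sqrt 3 - 1 / (4 * Real.sqrt 3 * (4 * K + 1))) := by
  intro hd v hv hdiv M hM hω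
  have hD : ∀ m, Torus.IsSmooth (Torus.partialDeriv m v) := fun m => hv.partialDeriv m
  have hDc : ∀ m j, Torus.IsSmooth (fun y => Torus.partialDeriv m v y j) :=
    fun m j => (hD m).apply j
  set B : UnitAddTorus d → ℝ := fun x => ∑ i, ∑ j, ∑ k, Torus.partialDeriv j v x i *
    Torus.partialDeriv k v x j * Torus.partialDeriv i v x k with hB_def
  set C : UnitAddTorus d → ℝ := fun x => ∑ m, ∑ i, Torus.partialDeriv m v x i *
    ⟪Torus.partialDeriv m v x, Torus.partialDeriv i v x⟫_ℝ with hC_def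
  set X : UnitAddTorus d → ℝ := fun x => strainNormSqAt v x with hX_def
  set q : UnitAddTorus d → ℝ := fun x => torusVorticitySqAt v x with hq_def
  set P : UnitAddTorus d → ℝ := fun x => Real.sqrt (X x) with hP_def
  set W : UnitAddTorus d → ℝ := fun x => Real.sqrt (q x) with hW_def
  set Df : UnitAddTorus d → ℝ := fun x => (Real.sqrt 2 * P x - W x) ^ 2 with hDf_def
  -- smoothness / continuity / integrability
  have hBs : Torus.IsSmooth B := by
    have h : ∀ i j k, Torus.IsSmooth (fun x => Torus.partialDeriv j v x i *
        Torus.partialDeriv k v x j * Torus.partialDeriv i v x k) :=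
      fun i j k => ((hDc j i).mul (hDc k j)).mul (hDc i k)
    unfold Torus.IsSmooth at h ⊢
    exact ContDiff.sum fun i _ => ContDiff.sum fun j _ => ContDiff.sum fun k _ => h i j k
  have hCs : Torus.IsSmooth C := by
    have h : ∀ m i, Torus.IsSmooth (fun x => Torus.partialDeriv m v x i *
        ⟪Torus.partialDeriv m v x, Torus.partialDeriv i v x⟫_ℝ) :=
      fun m i => (hDc m i).mul ((hD m).inner (hD i))
    unfold Torus.IsSmooth at h ⊢
    exact ContDiff.sum fun m _ => ContDiff.sum fun i _ => h m i
  have hXs : Torus.IsSmooth X := by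
    have h : ∀ i j, Torus.IsSmooth (fun x =>
        ((Torus.partialDeriv j v x i + Torus.partialDeriv i v x j) / 2) ^ 2) :=
      fun i j => (((hDc j i).add (hDc i j)).div_const 2).pow 2
    show Torus.IsSmooth (fun x => ∑ i, ∑ j,
      ((Torus.partialDeriv j v x i + Torus.partialDeriv i v x j) / 2) ^ 2)
    unfold Torus.IsSmooth at h ⊢
    exact ContDiff.sum fun i _ => ContDiff.sum fun j _ => h i j
  have hqs : Torus.IsSmooth q := by
    have h : ∀ i j, Torus.IsSmooth (fun x =>
        ((Torus.partialDeriv i v x) j - (Torus.partialDeriv j v x) i) ^ 2) :=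
      fun i j => ((hDc i j).sub (hDc j i)).pow 2
    have hsum : Torus.IsSmooth (fun x => ∑ i, ∑ j,
        ((Torus.partialDeriv i v x) j - (Torus.partialDeriv j v x) i) ^ 2) := by
      unfold Torus.IsSmooth at h ⊢
      exact ContDiff.sum fun i _ => ContDiff.sum fun j _ => h i j
    have : q = fun x => 2⁻¹ * ∑ i, ∑ j,
        ((Torus.partialDeriv i v x) j - (Torus.partialDeriv j v x) i) ^ 2 := rfl
    rw [this]
    exact hsum.smul 2⁻¹
  have hXc : Continuous X := hXs.continuous
  have hqc : Continuous q := hqs.continuous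
  have hPc : Continuous P := hXc.sqrt
  have hWc : Continuous W := hqc.sqrt
  have hDfc : Continuous Df := ((continuous_const.mul hPc).sub hWc).pow 2
  have hXi : Integrable X := hXc.integrable_unitAddTorus
  have hqi : Integrable q := hqc.integrable_unitAddTorus
  have hDfi : Integrable Df := hDfc.integrable_unitAddTorus
  have hX0 : ∀ x, 0 ≤ X x := fun x => strainNormSqAt_nonneg v x
  have hq0 : ∀ x, 0 ≤ q x := fun x => torusVorticitySqAt_nonneg v x
  have hDf0 : ∀ x, 0 ≤ Df x := fun x => sq_nonneg _
  have hΔ0 : 0 ≤ ∫ x, Df x := integral_nonneg hDf0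
  have hE0 : 0 ≤ torusEnstrophy v := torusEnstrophy_nonneg v
  -- the two global identities `∫|S|² = ℰ`, `∫|ω|² = 2ℰ`
  have hIX : ∫ x, X x = torusEnstrophy v := integral_strainNormSq_eq_torusEnstrophy hv hdiv
  have hIq : ∫ x, q x = 2 * torusEnstrophy v :=
    integral_torusVorticitySqAt_eq_two_mul_torusEnstrophy hv hdiv
  -- the production in orthogonality form, Betchov
  have hcomm : enstrophyProduction v = ∫ x, ⟪Torus.laplacian v x, Torus.convect v v x⟫_ℝ := by
    unfold enstrophyProduction
    exact congrArg (fun f : UnitAddTorus d → ℝ => ∫ x, f x)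
      (funext fun x => real_inner_comm (Torus.laplacian v x) (Torus.convect v v x))
  have horth : ∫ x, ⟪Torus.laplacian v x, Torus.convect v v x⟫_ℝ = -∫ x, C x :=
    Torus.integral_inner_laplacian_convect_self_eq_neg hv hdiv
  have hBet : ∫ x, B x = 0 := integral_sum_partialDeriv_cube_eq_zero hv hdiv
  have hdiff : -∫ x, C x = ∫ x, (B x - C x) := by
    rw [integral_sub hBs.integrable hCs.integrable, hBet, zero_sub]
  have hσC : enstrophyProduction v = -∫ x, C x := by rw [hcomm, horth]
  have hσBC : enstrophyProduction v = ∫ x, (B x - C x) := by rw [hσC, hdiff]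
  -- (E1): Hölder with the Cauchy–Schwarz deficit
  have hpt1 : ∀ x, B x - C x ≤ M / Real.sqrt 3 * (X x + 2⁻¹ * q x - 2⁻¹ * Df x) := fun x =>
    sum_partialDeriv_cube_sub_stretch_le_deficit hd hv hdiv hM x (hω x)
  have hE1 : enstrophyProduction v ≤
      M / Real.sqrt 3 * (2 * torusEnstrophy v - (∫ x, Df x) / 2) := by
    have hGi : Integrable (fun x => M / Real.sqrt 3 * (X x + 2⁻¹ * q x - 2⁻¹ * Df x)) :=
      ((hXi.add (hqi.const_mul _)).sub (hDfi.const_mul _)).const_mul _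
    have hmono : ∫ x, (B x - C x) ≤ ∫ x, M / Real.sqrt 3 * (X x + 2⁻¹ * q x - 2⁻¹ * Df x) :=
      integral_mono (hBs.integrable.sub hCs.integrable) hGi hpt1
    have hi2 : Integrable (fun x => 2⁻¹ * q x) := hqi.const_mul _
    have hi3 : Integrable (fun x => 2⁻¹ * Df x) := hDfi.const_mul _
    have hi12 : Integrable (fun x => X x + 2⁻¹ * q x) := hXi.add hi2
    have hval : ∫ x, M / Real.sqrt 3 * (X x + 2⁻¹ * q x - 2⁻¹ * Df x) =
        M / Real.sqrt 3 * (2 * torusEnstrophy v - (∫ x, Df x) / 2) := by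
      rw [integral_const_mul, integral_sub hi12 hi3, integral_add hXi hi2, integral_const_mul,
        integral_const_mul, hIX, hIq]
      ring
    rw [hσBC]
    exact hmono.trans_eq hval
  -- the case `M = 0`: (E1) alone gives `σ ≤ 0`
  rcases hM.eq_or_lt with hM0 | hMpos
  · rw [← hM0] at hE1 ⊢
    have : enstrophyProduction v ≤ 0 := by simpa using hE1
    simpa using this
  -- (E2): Betchov–Miller `σ ≤ (2√6/9)∫|S|³` and the Young split of `|S|³`
  have hE2a : -∫ x, C x ≤ 2 / 9 * Real.sqrt 6 * ∫ x, X x * Real.sqrt (X x) :=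
    neg_integral_stretching_le_strain_cube hd hv hdiv
  set t : ℝ := 1 / (8 * K + 2) with ht_def
  have h8 : 0 < 8 * K + 2 := by linarith
  have ht : 0 < t := by positivity
  have hpt2 : ∀ x, X x * Real.sqrt (X x) ≤
      M / 2 * (X x / Real.sqrt 2 + q x / (2 * Real.sqrt 2)) + M / (4 * t) * Df x +
        t / (4 * M) * (4 * (X x) ^ 2 + 2 * X x * q x) := by
    intro x
    have hPx2 : P x ^ 2 = X x := Real.sq_sqrt (hX0 x)
    have hWx2 : W x ^ 2 = q x := Real.sq_sqrt (hq0 x)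
    have hWM : W x ≤ M := by
      calc W x = Real.sqrt (q x) := rfl
        _ ≤ Real.sqrt (M ^ 2) := Real.sqrt_le_sqrt (hω x)
        _ = M := Real.sqrt_sq hM
    have h := HolderStretching.cube_le_young (Real.sqrt_nonneg (X x)) (Real.sqrt_nonneg (q x))
      hWM hMpos ht
    rw [hPx2, hWx2] at h
    exact h
  -- integrate (E2)'s pointwise bound
  set f1 : UnitAddTorus d → ℝ := fun x => M / 2 * (X x / Real.sqrt 2 + q x / (2 * Real.sqrt 2))
    with hf1
  set f2 : UnitAddTorus d → ℝ := fun x => M / (4 * t) * Df x with hf2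
  set f3 : UnitAddTorus d → ℝ := fun x => t / (4 * M) * (4 * (X x) ^ 2 + 2 * X x * q x) with hf3
  have hXd : Integrable (fun x => X x / Real.sqrt 2) := hXi.div_const _
  have hqd : Integrable (fun x => q x / (2 * Real.sqrt 2)) := hqi.div_const _
  have hf1i : Integrable f1 :=
    (continuous_const.mul ((hXc.div_const _).add (hqc.div_const _))).integrable_unitAddTorus
  have hf2i : Integrable f2 := hDfi.const_mul _
  have hX2i : Integrable (fun x => (X x) ^ 2) := (hXc.pow 2).integrable_unitAddTorus
  have hX4i : Integrable (fun x => 4 * (X x) ^ 2) := hX2i.const_mul 4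
  have hXqi : Integrable (fun x => X x * q x) := (hXc.mul hqc).integrable_unitAddTorus
  have hXq2i : Integrable (fun x => 2 * X x * q x) :=
    ((continuous_const.mul hXc).mul hqc).integrable_unitAddTorus
  have hq2i : Integrable (fun x => (q x) ^ 2) := (hqc.pow 2).integrable_unitAddTorus
  have hf3i : Integrable f3 :=
    (continuous_const.mul ((continuous_const.mul (hXc.pow 2)).add
      ((continuous_const.mul hXc).mul hqc))).integrable_unitAddTorus
  have hXPi : Integrable (fun x => X x * Real.sqrt (X x)) := (hXc.mul hPc).integrable_unitAddTorus
  have hI2 : ∫ x, X x * Real.sqrt (X x) ≤ (∫ x, f1 x) + (∫ x, f2 x) + ∫ x, f3 x := by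
    have hf12i : Integrable (fun x => f1 x + f2 x) := hf1i.add hf2i
    have hf123i : Integrable (fun x => f1 x + f2 x + f3 x) := hf12i.add hf3i
    have hmono : ∫ x, X x * Real.sqrt (X x) ≤ ∫ x, (f1 x + f2 x + f3 x) :=
      integral_mono hXPi hf123i hpt2
    rw [integral_add hf12i hf3i, integral_add hf1i hf2i] at hmono
    exact hmono
  have hI1v : ∫ x, f1 x = M * torusEnstrophy v / Real.sqrt 2 := by
    rw [hf1, integral_const_mul, integral_add hXd hqd, integral_div, integral_div, hIX, hIq]
    field_simp
    ring
  have hI2v : ∫ x, f2 x = M / (4 * t) * ∫ x, Df x := by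
    rw [hf2, integral_const_mul]
  -- `∫|S|⁴ ≤ K∫|ω|⁴ ≤ 2KM²ℰ` and `∫|S|²|ω|² ≤ M²ℰ`
  have hX2 : ∫ x, (X x) ^ 2 ≤ K * (M ^ 2 * (2 * torusEnstrophy v)) := by
    have hcz : ∫ x, (X x) ^ 2 ≤ K * ∫ x, (q x) ^ 2 := hCZ hd v hv hdiv
    have hq2 : ∫ x, (q x) ^ 2 ≤ M ^ 2 * (2 * torusEnstrophy v) := by
      have hpt : ∀ x, (q x) ^ 2 ≤ M ^ 2 * q x := fun x => by
        rw [sq]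
        exact mul_le_mul_of_nonneg_right (hω x) (hq0 x)
      calc ∫ x, (q x) ^ 2 ≤ ∫ x, M ^ 2 * q x := integral_mono hq2i (hqi.const_mul _) hpt
        _ = M ^ 2 * (2 * torusEnstrophy v) := by rw [integral_const_mul, hIq]
    exact hcz.trans (mul_le_mul_of_nonneg_left hq2 hK)
  have hXq : ∫ x, X x * q x ≤ M ^ 2 * torusEnstrophy v := by
    have hpt : ∀ x, X x * q x ≤ M ^ 2 * X x := fun x => by
      rw [mul_comm]
      exact mul_le_mul_of_nonneg_right (hω x) (hX0 x)
    calc ∫ x, X x * q x ≤ ∫ x, M ^ 2 * X x := integral_mono hXqi (hXi.const_mul _) hpt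
      _ = M ^ 2 * torusEnstrophy v := by rw [integral_const_mul, hIX]
  have hI3v : ∫ x, f3 x ≤ M * torusEnstrophy v / 4 := by
    have heq : ∫ x, f3 x = t / (4 * M) * ((∫ x, 4 * (X x) ^ 2) + ∫ x, 2 * X x * q x) := by
      rw [hf3, integral_const_mul, integral_add hX4i hXq2i]
    have h4 : ∫ x, 4 * (X x) ^ 2 ≤ 4 * (K * (M ^ 2 * (2 * torusEnstrophy v))) := by
      rw [integral_const_mul]; linarith [hX2]
    have h2' : ∫ x, 2 * X x * q x ≤ 2 * (M ^ 2 * torusEnstrophy v) := by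
      have : (fun x => 2 * X x * q x) = fun x => 2 * (X x * q x) :=
        funext fun x => mul_assoc _ _ _
      rw [this, integral_const_mul]; linarith [hXq]
    rw [heq]
    have hc : 0 ≤ t / (4 * M) := by positivity
    calc t / (4 * M) * ((∫ x, 4 * (X x) ^ 2) + ∫ x, 2 * X x * q x)
        ≤ t / (4 * M) * (4 * (K * (M ^ 2 * (2 * torusEnstrophy v))) +
            2 * (M ^ 2 * torusEnstrophy v)) := by
          apply mul_le_mul_of_nonneg_left _ hc
          linarith [h4, h2']
      _ = M * torusEnstrophy v / 4 := by
          rw [ht_def]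
          field_simp
          ring
  have hE2 : enstrophyProduction v ≤ 2 / 9 * Real.sqrt 6 *
      (M * torusEnstrophy v / Real.sqrt 2 + M * ((8 * K + 2) / 4) * (∫ x, Df x) +
        M * torusEnstrophy v / 4) := by
    have h4t : M / (4 * t) = M * ((8 * K + 2) / 4) := by
      rw [ht_def]
      field_simp
    have hsum : ∫ x, X x * Real.sqrt (X x) ≤ M * torusEnstrophy v / Real.sqrt 2 +
        M * ((8 * K + 2) / 4) * (∫ x, Df x) + M * torusEnstrophy v / 4 := by
      rw [← h4t, ← hI1v, ← hI2v]
      linarith [hI2, hI3v]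
    have h60 : 0 ≤ 2 / 9 * Real.sqrt 6 := by positivity
    rw [hσC]
    exact hE2a.trans (mul_le_mul_of_nonneg_left hsum h60)
  exact stretching_endgame hK hE0 hM hE1 hE2

/-- **`StretchingSupSharp` FAILS given the `L⁴` bound** (K1-Q1 of the dictionary decided: Hölder's
constant is not optimal): `StrainL4Bound K` with `K ≥ 0` yields a constant `< 2/√3`.
[ours, UNREVIEWED — K1Q1.md] -/
theorem not_stretchingSupSharp_of_strainL4Bound {K : ℝ} (hK : 0 ≤ K)
    (hCZ : StrainL4Bound (d := d) K) : ¬ StretchingSupSharp (d := d) := by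
  intro hsharp
  have h := hsharp _ (stretchingSupBound_of_strainL4Bound hK hCZ)
  have hs3 : 0 < Real.sqrt 3 := Real.sqrt_pos.2 (by norm_num)
  have hpos : 0 < 1 / (4 * Real.sqrt 3 * (4 * K + 1)) := by positivity
  linarith

end Summit.NavierStokesRegularity.FunctionalMining

end
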